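import Summits.ResolutionOfSingularities.ResolutionOfSingularities.Theorems.StallVertexKernels
import Summits.ResolutionOfSingularities.ResolutionOfSingularities.Theorems.StallVertexClean
import HarnessLib

/-!
# StallVertexRigid — decomp-res node «StallVertex» (lens-5 g20 rev 2), tree file 6/9 of the node

Content VERBATIM from the decomp-res lens-5 g20 file
`HOME/decomp-res-lens-5/g20/parts/StallVertex-g20-rev2-d6168cb0.lean` (1724 l; rev 2, which SUPERSEDES
the pins 0349e14d (869 l) and rev 1 d60a69dd with all earlier statements byte-identical; HOME =
run/shared/lean/pub/decomp-res).  The rev-0 sections §1/§2/§3/§4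
are ALREADY in the tree from pin 0349e14d as `StallVertexForms` / `StallVertexKernels` / `StallVertexWalk` /
`StallVertexClasses`; this file carries ONLY
declarations NEW in rev 1 / rev 2.  Critic: CRITIC-LEDGER rows 142 (CLEARED 20:41:19Z: the stall vertex law), 142a
(21:01:24Z: rev 1 stall rigidity), 142b
(21:17:44Z: rev 2 contact-line law; ONE located-residual aside = `StallVertex.NoLineFreeRigidSkewStalledTailsDeep`,
the sharpest exact form, chain
skew ↔ vertexBound ↔ rigid ↔ lineFree hypothesis-free, superseding `CoefficientCut.NoSkewJointTailsDeep`).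
Landed by decomp-res writer g7.  Every file of the
node is in the Theses cone (the lens imports the in-cone `DifferentialShade`), so the residual is booked on the
route by RE-LOCATING the existing aside 28122
`CFNoSkewJointTailsDeep` (EXACTLY ⟺ it) — one aside, not two.

§2 addition of rev 1 (l. 801–1054, `section Vertex`): **STALL RIGIDITY `stall_rigid`** — at a `μ̃`-stall the
vertex law is an EQUALITY, Lemma A is tight,
minimisers persist, `μ_P(t+1) = 2 μ_P(t) − 1 − lostMass(t)`, `μ_{P,D_j}(t+1) = μ_P(t) − 1`
(Kawanoue–Matsuki's recursion, exact; kernel, hypothesis-free).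
PROVED, 0 sorry.  Imports the landed `StallVertexKernels` (`stall_vertex`) and `StallVertexClean`.

[WRITER NOTE (decomp-res writer g7): file split only; namespace, opens, section variables and every declaration
exactly as in the lens (global `set_option` dropped; the lens's `set_option maxHeartbeats … in` on `stall_rigid` kept).]

(Sources: KawanoueMatsuki2016 Prop. 4 (2), §4.1; Hauser2010; HauserPerlega2024; Moh1987; CossartPiltant2008;
Giraud1975; Hironaka1964; ZariskiSamuelII Ch. VIII §2.)
-/

noncomputable section

open MvPolynomial Finset
open Literature.AlgebraicGeometry.Resolution
open Literature.AlgebraicGeometry.Resolution.Hauser2010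
open Literature.AlgebraicGeometry.Resolution.HauserPerlega2024
open Literature.Barriers.ResolutionOfSingularities
open Literature.AlgebraicGeometry.Resolution.PointBlowup
open Summit.ResolutionOfSingularities.ResolutionOfSingularities.Theses
open Summit.ResolutionOfSingularities.ResolutionOfSingularities.Theorems.TightDefectClasses
open Summit.ResolutionOfSingularities.ResolutionOfSingularities.Theorems.ProximityCut
open Summit.ResolutionOfSingularities.ResolutionOfSingularities.Theorems.ExitLaw
open Summit.ResolutionOfSingularities.ResolutionOfSingularities.Theorems.DifferentialShade

namespace Summit.ResolutionOfSingularities.ResolutionOfSingularities.Theorems.StallVertex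

section Vertex

variable {σ : Type*} {K : Type*} [Field K] [Fintype σ] [DecidableEq σ] [DecidableEq K]

set_option maxHeartbeats 1000000 in
/-- **STALL RIGIDITY: THE LAW IS AN EQUALITY, LEMMA A IS TIGHT, MINIMISERS PERSIST.**  At a `μ̃`-stall, for EVERY
`μ_P`-minimiser `g₀` (notation of `stall_vertex`): (1) the vertex order is EXACTLY `ord₀ dirForm = d₀ - a₀·lostMass`
(in particular `a₀·lostMass ∈ ℕ`); (2) the sharp layer bound is attained: `ord₀ g₀' = (d₀ - a₀) +
ord₀ dirForm`;
(3) `g₀` is again a `μ_P`-minimiser after the move (PERSISTENCE); (4) the new value is `μ_P' = 2μ_P - 1 - lostMass`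
(Kawanoue–Matsuki's recursion, exact); (5) the new exceptional component has `μ_{P',D_j} = μ_P - 1` EXACTLY.
Proof: the universal upper bound `ordZero_dirForm_add_le` (the young monomial `∏ u_i^{ord_{u_i} g₀}` over the lost
components is a unit at the new point and `a₀ μ_{P,D_i} ≤ ord_{u_i} g₀`) closes the K–M chain of `stall_vertex` from
above, so every inequality in it is an equality.  This EXPLAINS the census (law with equality 1167/1167, minimiser
persistence 1096/1096 on the g18 beds) and makes the located residual's dynamics EXACT: along a stalled tail the
`μ_P`-ledger obeys `μ_P(t+1) = 2 μ_P(t) - 1 - lostMass(t)` and the minimising index set is non-decreasing.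
(Sources: KawanoueMatsuki2016, Proposition 4 (2), §4.1; new.) -/
theorem stall_rigid (q : ℕ) (j : σ) (b : σ → K) (hbj : b j = 0) (t : IFPState σ K)
    (hlev : ∀ J ∈ t.idx, J.degree < q)
    (hsing : ∀ J ∈ t.idx, t.gen J ≠ 0 → (((q - J.degree : ℕ) : ℕ∞)) ≤ ordZero (t.gen J))
    (hstall : t.muTilde q ≤ (t.step q j b).muTilde q)
    {J₀ : σ →₀ ℕ} (hJ₀ : J₀ ∈ t.idx) (hμ : t.muP q = levelRatio (ordZero (t.gen J₀)) (q - J₀.degree))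
    {d₀ : ℕ} (hd₀ : ordZero (t.gen J₀) = d₀) :
    (((ordZero (dirForm d₀ j b (t.gen J₀))).toNat : ℚ) = (d₀ : ℚ) - (q - J₀.degree : ℕ) * lostMass q j b t) ∧
    (ordZero ((t.step q j b).gen J₀) =
        ((d₀ - (q - J₀.degree) + (ordZero (dirForm d₀ j b (t.gen J₀))).toNat : ℕ) : ℕ∞)) ∧
    ((t.step q j b).muP q = levelRatio (ordZero ((t.step q j b).gen J₀)) (q - J₀.degree)) ∧
    ((t.step q j b).muP q = (((2 * ((d₀ : ℚ) / (q - J₀.degree : ℕ)) - 1 - lostMass q j b t : ℚ)) : WithTop ℚ)) ∧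
    ((t.step q j b).muPD q j = ((((d₀ : ℚ) / (q - J₀.degree : ℕ)) - 1 : ℚ) : WithTop ℚ)) := by
  classical
  have hstall' := hstall
  set g₀ := t.gen J₀ with hg₀
  set a₀ : ℕ := q - J₀.degree with ha₀
  have hg₀ne : g₀ ≠ 0 := by
    intro h0
    rw [h0, ordZero_zero] at hd₀
    exact ENat.top_ne_coe _ hd₀
  have htop : t.muP q ≠ ⊤ := by
    rw [hμ, hd₀, levelRatio_natCast]; exact WithTop.coe_ne_top
  have ha₀pos : 0 < a₀ := by have := hlev J₀ hJ₀; omega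
  have had₀ : a₀ ≤ d₀ := by
    have := hsing J₀ hJ₀ hg₀ne
    rw [← hg₀, hd₀] at this
    exact_mod_cast this
  have ha₀q : (0 : ℚ) < a₀ := by exact_mod_cast ha₀pos
  -- μ_P = d₀ / a₀
  have hμval : t.muP q = (((d₀ : ℚ) / a₀ : ℚ) : WithTop ℚ) := by
    rw [hμ, hd₀]; rfl
  set m : ℚ := (d₀ : ℚ) / a₀ with hm
  have hma : m * a₀ = d₀ := by rw [hm]; exact div_mul_cancel₀ _ ha₀q.ne'
  have hratio : ∀ J ∈ t.idx, (m : WithTop ℚ) ≤ levelRatio (ordZero (t.gen J)) (q - J.degree) := by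
    intro J hJ
    rw [← hμval]
    exact Finset.inf_le hJ
  -- the transported state
  set t' := t.step q j b with ht'
  have hgen' : ∀ J, t'.gen J = PointBlowup.translate b (chartTransform (q - J.degree) j (t.gen J)) := fun J => rfl
  have hidx' : t'.idx = t.idx := rfl
  have hyoung' : t'.young = insert j (t.young.filter fun i => b i = 0) := rfl
  set Kept : Finset σ := (t.young.erase j).filter fun i => b i = 0 with hKept
  set ε : σ → ℕ := fun i => (divisorOrder i g₀).toNat with hε
  -- (1') THE LAYER BOUND in place of the Moh monomial: μ_P' ≤ ((d₀ - a₀) + n) / a₀, n = ord (dirForm)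
  set T := dirForm d₀ j b g₀ with hTdef
  have hTne : T ≠ 0 := dirForm_ne_zero j b hd₀
  set n : ℕ := (ordZero T).toNat with hn
  have hTn : ordZero T = n := (coe_toNat_ordZero hTne).symm
  have hg₀' : t'.gen J₀ = PointBlowup.translate b (chartTransform a₀ j g₀) := hgen' J₀
  have hA : ordZero (t'.gen J₀) ≤ ((d₀ - a₀ + n : ℕ) : ℕ∞) := by
    rw [hg₀', Nat.cast_add, ← hTn]
    exact ordZero_move_le_layer b hbj had₀ hd₀
  have hg₀'ne : t'.gen J₀ ≠ 0 := by
    intro h0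
    rw [h0, ordZero_zero, top_le_iff] at hA
    exact ENat.coe_ne_top _ hA
  set M : ℚ := ((d₀ : ℚ) - a₀ + n) / a₀ with hM
  have hMa : M * a₀ = (d₀ : ℚ) - a₀ + n := by rw [hM]; exact div_mul_cancel₀ _ ha₀q.ne'
  have hμ'le : t'.muP q ≤ ((M : ℚ) : WithTop ℚ) := by
    calc t'.muP q ≤ levelRatio (ordZero (t'.gen J₀)) (q - J₀.degree) := Finset.inf_le (hidx' ▸ hJ₀)
      _ ≤ levelRatio ((d₀ - a₀ + n : ℕ) : ℕ∞) a₀ := levelRatio_mono hA a₀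
      _ = ((((d₀ - a₀ + n : ℕ) : ℚ) / a₀ : ℚ) : WithTop ℚ) := levelRatio_natCast _ _
      _ = ((M : ℚ) : WithTop ℚ) := by rw [hM, Nat.cast_add, Nat.cast_sub had₀]
  have hμ'ne : t'.muP q ≠ ⊤ := ne_top_of_le_ne_top WithTop.coe_ne_top hμ'le
  obtain ⟨m', hm'⟩ := WithTop.ne_top_iff_exists.mp hμ'ne
  have hm'le : m' ≤ M := by
    have := hμ'le; rw [← hm'] at this; exact WithTop.coe_le_coe.mp this
  -- (2) μ_{P',D_j} ≥ m − 1 (as in Prop. 4 (2))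
  have hnew : ((m - 1 : ℚ) : WithTop ℚ) ≤ t'.muPD q j := by
    refine Finset.le_inf fun J hJ => ?_
    rw [hidx'] at hJ
    rw [hgen']
    by_cases hJ0 : t.gen J = 0
    · rw [hJ0, chartTransform_zero]
      unfold PointBlowup.translate PointBlowup.divisorOrder
      rw [map_zero, MvPolynomial.support_zero, Finset.inf_empty, levelRatio_top]
      exact le_top
    obtain ⟨dJ, hdJ⟩ := exists_ordZero_eq_natCast hJ0
    have haJ : q - J.degree ≤ dJ := by
      have := hsing J hJ hJ0; rw [hdJ] at this; exact_mod_cast this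
    have haJpos : (0 : ℚ) < (q - J.degree : ℕ) := by
      have := hlev J hJ; exact_mod_cast (by omega : 0 < q - J.degree)
    have h1 := le_divisorOrder_new b hbj (q - J.degree) (t.gen J)
    rw [hdJ, ENat.toNat_coe] at h1
    calc ((m - 1 : ℚ) : WithTop ℚ) ≤ ((((dJ - (q - J.degree) : ℕ) : ℚ) / (q - J.degree : ℕ) : ℚ) : WithTop ℚ) := by
          rw [WithTop.coe_le_coe]
          have hr := hratio J hJ
          rw [hdJ, levelRatio_natCast, WithTop.coe_le_coe] at hr
          rw [Nat.cast_sub haJ, sub_div, div_self (ne_of_gt haJpos)]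
          linarith
      _ = levelRatio ((dJ - (q - J.degree) : ℕ) : ℕ∞) (q - J.degree) := (levelRatio_natCast _ _).symm
      _ ≤ levelRatio (divisorOrder j (PointBlowup.translate b (chartTransform (q - J.degree) j (t.gen J)))) (q - J.degree) :=
          levelRatio_mono h1 _
  -- (3) kept components: μ_{P',D_i} ≥ μ_{P,D_i}
  have hkept : ∀ i ∈ Kept, t.muPD q i ≤ t'.muPD q i := by
    intro i hi
    have hij : i ≠ j := Finset.ne_of_mem_erase (Finset.mem_filter.mp hi).1
    have hbi : b i = 0 := (Finset.mem_filter.mp hi).2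
    refine Finset.le_inf fun J hJ => ?_
    rw [hidx'] at hJ
    rw [hgen']
    calc t.muPD q i ≤ levelRatio (divisorOrder i (t.gen J)) (q - J.degree) := Finset.inf_le hJ
      _ ≤ _ := levelRatio_mono (divisorOrder_le_divisorOrder_kept b hij hbi _ _) _
  -- finiteness
  have hPDfin : ∀ i, t.muPD q i ≤ (((ε i : ℚ) / a₀ : ℚ) : WithTop ℚ) := by
    intro i
    calc t.muPD q i ≤ levelRatio (divisorOrder i g₀) (q - J₀.degree) := Finset.inf_le hJ₀
      _ = _ := by rw [← ENat.coe_toNat (divisorOrder_ne_top (i := i) hg₀ne)]; exact levelRatio_natCast _ _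
  have hPD'fin : ∀ i, t'.muPD q i ≠ ⊤ := by
    intro i
    have h1 : t'.muPD q i ≤ levelRatio (divisorOrder i (t'.gen J₀)) (q - J₀.degree) := Finset.inf_le (hidx' ▸ hJ₀)
    rw [← ENat.coe_toNat (divisorOrder_ne_top (i := i) hg₀'ne), levelRatio_natCast] at h1
    exact ne_top_of_le_ne_top WithTop.coe_ne_top h1
  -- the numbers
  set u : σ → ℚ := fun i => (t.muPD q i).untopD 0 with hu
  set u' : σ → ℚ := fun i => (t'.muPD q i).untopD 0 with hu'
  have hu'j : m - 1 ≤ u' j := le_untopD_of_coe_le hnew (hPD'fin j)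
  have hu'kept : ∀ i ∈ Kept, u i ≤ u' i := fun i hi => untopD_le_untopD (hkept i hi) (hPD'fin i)
  -- unfold the two μ̃'s in the stall hypothesis
  have hμt : t.muTilde q = ((m - ∑ i ∈ t.young, u i : ℚ) : WithTop ℚ) := by
    unfold IFPState.muTilde; rw [hμval]; rfl
  have hμt' : t'.muTilde q = ((m' - ∑ i ∈ t'.young, u' i : ℚ) : WithTop ℚ) := by
    unfold IFPState.muTilde; rw [← hm']; rfl
  rw [hμt, hμt', WithTop.coe_le_coe] at hstall
  -- sums over young' and young
  have hsum' : u' j + ∑ i ∈ Kept, u' i ≤ ∑ i ∈ t'.young, u' i := by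
    have hj : j ∈ t'.young := IFPState.mem_young_step q j b t
    rw [← Finset.add_sum_erase _ _ hj, hyoung', Finset.erase_insert_eq_erase, hKept]
    have : (t.young.erase j).filter (fun i => b i = 0) = (t.young.filter fun i => b i = 0).erase j := by
      ext i; simp [Finset.mem_filter, Finset.mem_erase, and_assoc]
    rw [this]
  have hKeptEq : Kept = t.young.filter fun i => ¬ (i = j ∨ b i ≠ 0) := by
    ext i
    simp only [hKept, Finset.mem_filter, Finset.mem_erase, not_or, not_not]
    tauto
  have hsplit : ∑ i ∈ t.young, u i = lostMass q j b t + ∑ i ∈ Kept, u i := by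
    rw [hKeptEq, lostMass]
    exact (Finset.sum_filter_add_sum_filter_not t.young (fun i => i = j ∨ b i ≠ 0) u).symm
  have hKsum : ∑ i ∈ Kept, u i ≤ ∑ i ∈ Kept, u' i := Finset.sum_le_sum fun i hi => hu'kept i hi
  -- (UB) THE UNIVERSAL UPPER BOUND `n + a₀·lostMass ≤ d₀` (`ordZero_dirForm_add_le` with the divisor orders of `g₀`)
  set S : Finset σ := t.young.filter fun i => b i ≠ 0 with hS
  have hjS : j ∉ S := by
    rw [hS, Finset.mem_filter, not_and, not_not]; exact fun _ => hbj
  set sx : σ →₀ ℕ := ∑ i ∈ S, Finsupp.single i (ε i) with hsx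
  have hsx_apply : ∀ i, sx i = if i ∈ S then ε i else 0 := by
    intro i
    rw [hsx, Finsupp.coe_finsetSum, Finset.sum_apply]
    simp_rw [Finsupp.single_apply]
    exact Finset.sum_ite_eq' S i ε
  have hsx_deg : sx.degree = ∑ i ∈ S, ε i := by
    rw [hsx, map_sum]
    exact Finset.sum_congr rfl fun i _ => Finsupp.degree_single _ _
  set kx : ℕ := if j ∈ t.young then ε j else 0 with hkx
  have hεle : ∀ e ∈ g₀.support, ∀ i, ε i ≤ e i := fun e he i => by
    have h := divisorOrder_le_exponent (i := i) he
    rw [← ENat.coe_toNat (divisorOrder_ne_top (i := i) hg₀ne)] at h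
    exact_mod_cast h
  have hGx : ∀ e ∈ g₀.support, sx ≤ e ∧ kx ≤ e j := by
    intro e he
    refine ⟨fun i => ?_, ?_⟩
    · rw [hsx_apply]
      split_ifs
      · exact hεle e he i
      · exact Nat.zero_le _
    · rw [hkx]
      split_ifs
      · exact hεle e he j
      · exact Nat.zero_le _
  have hsxj : sx j = 0 := by rw [hsx_apply, if_neg hjS]
  have hsxb : ∀ i, sx i ≠ 0 → b i ≠ 0 := by
    intro i hi
    rw [hsx_apply] at hi
    split_ifs at hi with h
    · exact (Finset.mem_filter.mp h).2
    · exact absurd rfl hi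
  have hUB := ordZero_dirForm_add_le j b hd₀ sx hsxj hsxb kx hGx
  rw [hTn, ← Nat.cast_add, Nat.cast_le] at hUB
  -- `a₀ · lostMass ≤ kx + |sx|`
  have hui : ∀ i, (a₀ : ℚ) * u i ≤ ε i := fun i => by
    have h := untopD_le_of_le_coe (hPDfin i)
    rw [mul_comm]
    exact (le_div_iff₀ ha₀q).mp h
  have hF : t.young.filter (fun i => i = j ∨ b i ≠ 0) = t.young.filter (fun i => i = j) ∪ S := by
    rw [hS]; exact Finset.filter_or _ _ t.young
  have hdisj : Disjoint (t.young.filter (fun i => i = j)) S := by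
    rw [Finset.disjoint_left]
    intro i hi hiS
    rw [Finset.mem_filter] at hi
    rw [hi.2] at hiS
    exact hjS hiS
  have hL : (a₀ : ℚ) * lostMass q j b t ≤ (kx : ℚ) + sx.degree := by
    rw [lostMass, Finset.mul_sum, hF, Finset.sum_union hdisj, hsx_deg, hkx, Finset.filter_eq' t.young j]
    push_cast
    have h2 : ∑ i ∈ S, (a₀ : ℚ) * u i ≤ ∑ i ∈ S, (ε i : ℚ) := Finset.sum_le_sum fun i _ => hui i
    have h1 : ∑ i ∈ (if j ∈ t.young then ({j} : Finset σ) else ∅), (a₀ : ℚ) * u i ≤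
        (if j ∈ t.young then ((ε j : ℕ) : ℚ) else 0) := by
      split_ifs
      · rw [Finset.sum_singleton]; exact hui j
      · rw [Finset.sum_empty]
    exact add_le_add h1 h2
  have hUBq : (n : ℚ) + (a₀ : ℚ) * lostMass q j b t ≤ d₀ := by
    have h : ((n + (sx.degree + kx) : ℕ) : ℚ) ≤ d₀ := by exact_mod_cast hUB
    push_cast at h
    linarith [hL]
  -- the K–M chain is now a chain of EQUALITIES
  have hm'ge : 2 * m - 1 - lostMass q j b t ≤ m' := by
    linarith [hstall, hsum', hKsum, hu'j, hsplit]
  have hX : (2 * m - 1 - lostMass q j b t) * a₀ = 2 * d₀ - a₀ - a₀ * lostMass q j b t := by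
    rw [← hma]; ring
  have hMle : M ≤ 2 * m - 1 - lostMass q j b t := by
    refine le_of_mul_le_mul_right ?_ ha₀q
    rw [hMa, hX]
    linarith [hUBq]
  have hm'eq : m' = M := le_antisymm hm'le (hMle.trans hm'ge)
  have hMeq : M = 2 * m - 1 - lostMass q j b t := le_antisymm hMle (hm'ge.trans hm'le)
  have hlaw := stall_vertex q j b hbj t hlev hsing hstall' hJ₀ hμ hd₀
  -- the order of the transported minimiser
  obtain ⟨d', hd'⟩ := exists_ordZero_eq_natCast hg₀'ne
  have hlow : (((d₀ : ℚ) - a₀ + n : ℚ)) ≤ (d' : ℚ) := by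
    have h1 : t'.muP q ≤ levelRatio (ordZero (t'.gen J₀)) (q - J₀.degree) := Finset.inf_le (hidx' ▸ hJ₀)
    rw [hd', levelRatio_natCast, ← hm', WithTop.coe_le_coe, hm'eq] at h1
    exact (div_le_div_iff_of_pos_right ha₀q).mp (show M ≤ (d' : ℚ) / a₀ from h1)
  have hA' : d' ≤ d₀ - a₀ + n := by
    have h := hA; rw [hd'] at h; exact_mod_cast h
  have hd'eq : d' = d₀ - a₀ + n := by
    apply le_antisymm hA'
    have h : ((d₀ - a₀ + n : ℕ) : ℚ) ≤ d' := by push_cast [Nat.cast_sub had₀]; linarith [hlow]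
    exact_mod_cast h
  refine ⟨by linarith [hlaw, hUBq], by rw [hd', hd'eq], ?_, by rw [← hm', hm'eq, hMeq], ?_⟩
  · rw [hd', levelRatio_natCast, ← hm', hm'eq, hd'eq, hM]
    push_cast [Nat.cast_sub had₀]
    rfl
  · obtain ⟨y, hy⟩ := WithTop.ne_top_iff_exists.mp (hPD'fin j)
    have huy : u' j = y := by
      show (t'.muPD q j).untopD 0 = y
      rw [← hy]; rfl
    have hup : u' j ≤ m - 1 := by
      linarith [hstall, hsum', hKsum, hsplit, hm'eq, hMeq, hm'ge]
    have hyeq : y = m - 1 := by rw [← huy]; exact le_antisymm hup hu'j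
    rw [← hy, hyeq]

end Vertex

end Summit.ResolutionOfSingularities.ResolutionOfSingularities.Theorems.StallVertex
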